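import Summits.ResolutionOfSingularities.ResolutionOfSingularities.Theorems.FrobeniusLadderFInjectiveMacaulayficationKLocCellOff
import HarnessLib

/-!
# E7 N5c (`Set.range` forms) — the chart clause over the centre off `V(P)` for `gs : Fin 1 → k[Y]` (crux `FInjectiveMacaulayfication`
# stmt-ResolutionOfSingularities-15315, chain w45a; companion of `…KLocCellOff`; owner res-D-pv-017 AS res-L1-w45a-stub-5)

Support file for crux stmt-ResolutionOfSingularities-15315 (`FrobeniusLadder.FInjectiveMacaulayfication`), chain w45a.
[OURS · L1 W4.5a] — NOT a statement of any manuscript; AI-written, weaker than expert review.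

The `r = 1` / `Ideal.span (Set.range gs)` twins of `KLocCellOff.quotientChartClause_of_pointFedder_off` and
`KLocCellOff.honQuot_of_kLocCells_off(')` — the currency of `CICertificates.ciCertificates` / `KLocCellRange` — by the route of
`KLocCellRange.quotientChartClause_of_pointFedder_range` (Fedder upstairs in `k[Y]_P ⧸ (g)` and
`CIFedderAtMaximalIdeal.nonempty_quotLocalizationEquiv`). No definitions, no named facts. [folklore; cite: Fedder1983, Prop. 1.7 and
Thm. 1.12]
-/

-- single-problem summit: the doubled namespace component is forced
set_option linter.dupNamespace false

noncomputable section

namespace Summit.ResolutionOfSingularities.ResolutionOfSingularities.Theorems.FInjectiveMacaulayfication.KLocCellOff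

open MvPolynomial
open Summit.ResolutionOfSingularities.ResolutionOfSingularities.Theorems.FInjectiveMacaulayfication
open Literature.RingTheory.TightClosure

section ChartRange

variable (p : ℕ) [Fact p.Prime] (k : Type) [Field k] [CharP k p] (n : ℕ)

/-! ## The `Set.range` (`r = 1`) forms -/

/-- **`hon` OFF `V(hs)` FROM POINT-FEDDER OFF `V(hs)`, `Set.range` form** (`gs : Fin 1 → k[Y]`, `g = gs 0`; the shape of
`CICertificates.ciCertificates` / `KLocCellRange.quotientChartClause_of_pointFedder_range`). [cite: Fedder1983, Prop. 1.7 and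
Thm. 1.12; folklore] -/
theorem quotientChartClause_of_pointFedder_off_range (J : Finset (Fin n)) (V : Matrix (Fin n) (Fin n) ℕ)
    (gs : Fin 1 → MvPolynomial (Fin n) k) (hg0 : gs 0 ≠ 0) (hX : ∀ i : Fin n, ¬ (MvPolynomial.X i ∣ gs 0))
    (hs : List (MvPolynomial (Fin n) k))
    (hfed : ∀ (K : Type) [Field K] [Algebra k K] (b : Fin n → K), MvPolynomial.aeval b (gs 0) = 0 →
      (∀ j ∈ J, MvPolynomial.aeval b (∏ i : Fin n, (X i : MvPolynomial (Fin n) k) ^ V i j) = 0) →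
      (∃ h ∈ hs, MvPolynomial.aeval b h ≠ 0) →
      (MvPolynomial.map (algebraMap k K) (gs 0)) ^ (p - 1) ∉
        Ideal.span (Set.range fun i : Fin n => (MvPolynomial.X i - MvPolynomial.C (b i)) ^ p)) :
    ∀ (Q' : Ideal (MvPolynomial (Fin n) k ⧸ Ideal.span (Set.range gs))) [Q'.IsMaximal],
      (∀ j ∈ J, Ideal.Quotient.mk (Ideal.span (Set.range gs))
        (aeval (fun j : Fin n => ∏ i : Fin n, (X i : MvPolynomial (Fin n) k) ^ V i j) (X j : MvPolynomial (Fin n) k)) ∈ Q') →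
      (∃ h ∈ hs, Ideal.Quotient.mk (Ideal.span (Set.range gs)) h ∉ Q') →
        (∀ i : Fin n, (X i : MvPolynomial (Fin n) k) ∈ Q'.comap (Ideal.Quotient.mk (Ideal.span (Set.range gs))) →
          IsSMulRegular (Localization.AtPrime (Q'.comap (Ideal.Quotient.mk (Ideal.span (Set.range gs)))) ⧸
              (Ideal.span (Set.range gs)).map (algebraMap (MvPolynomial (Fin n) k)
                (Localization.AtPrime (Q'.comap (Ideal.Quotient.mk (Ideal.span (Set.range gs)))))))
            (algebraMap (MvPolynomial (Fin n) k)
              (Localization.AtPrime (Q'.comap (Ideal.Quotient.mk (Ideal.span (Set.range gs))))) (X i))) ∧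
        ∀ dd : ℕ, ringKrullDim (Localization.AtPrime Q') = dd → ∀ s : Fin dd → Localization.AtPrime Q',
          (Ideal.span (Set.range s)).radical.IsMaximal →
            RingTheory.Sequence.IsWeaklyRegular (Localization.AtPrime Q') (List.ofFn s) ∧
            ∀ y : Localization.AtPrime Q', (∃ e : ℕ, y ^ p ^ e ∈ Ideal.span
              ((fun z : Localization.AtPrime Q' => z ^ p ^ e) ''
                (Ideal.span (Set.range s) : Set (Localization.AtPrime Q')))) → y ∈ Ideal.span (Set.range s) := by
  intro Q' _ hθ hhQ
  classical
  have hrange : Set.range gs = {gs 0} := by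
    ext x
    simp only [Set.mem_range, Set.mem_singleton_iff]
    exact ⟨fun ⟨i, hi⟩ => by rw [← hi, Fin.fin_one_eq_zero i], fun h => ⟨0, h.symm⟩⟩
  have hspan : Ideal.span (Set.range gs) = Ideal.span {gs 0} := by rw [hrange]
  -- the contraction `P`, residue field `K`, residue point `b`
  set P : Ideal (MvPolynomial (Fin n) k) := Q'.comap (Ideal.Quotient.mk (Ideal.span (Set.range gs))) with hP_def
  haveI hPmax : P.IsMaximal := Ideal.comap_isMaximal_of_surjective _ Ideal.Quotient.mk_surjective
  refine ⟨fun i _ => KLocCell.isSMulRegular_localization_quotient_of_prime_not_dvd P (PrimeTransfer.prime_X i) (hX i) _ hspan, ?_⟩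
  letI : Field (MvPolynomial (Fin n) k ⧸ P) := Ideal.Quotient.field P
  have hgP : gs 0 ∈ P := by
    rw [hP_def, Ideal.mem_comap, Ideal.Quotient.eq_zero_iff_mem.mpr (Ideal.subset_span (Set.mem_range_self 0))]
    exact Q'.zero_mem
  have haev : ∀ q : MvPolynomial (Fin n) k,
      MvPolynomial.aeval (fun i : Fin n => Ideal.Quotient.mk P (MvPolynomial.X i)) q = Ideal.Quotient.mk P q := by
    intro q
    have h : (MvPolynomial.aeval (R := k) (fun i : Fin n => Ideal.Quotient.mk P (MvPolynomial.X i))) =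
        Ideal.Quotient.mkₐ k P := MvPolynomial.algHom_ext fun i => by
      rw [MvPolynomial.aeval_X, Ideal.Quotient.mkₐ_eq_mk]
    rw [h, Ideal.Quotient.mkₐ_eq_mk]
  have hgb : MvPolynomial.aeval (fun i : Fin n => Ideal.Quotient.mk P (MvPolynomial.X i)) (gs 0) = 0 := by
    rw [haev, Ideal.Quotient.eq_zero_iff_mem]; exact hgP
  have hθb : ∀ j ∈ J, MvPolynomial.aeval (fun i : Fin n => Ideal.Quotient.mk P (MvPolynomial.X i))
      (∏ i : Fin n, (X i : MvPolynomial (Fin n) k) ^ V i j) = 0 := by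
    intro j hj
    rw [haev, Ideal.Quotient.eq_zero_iff_mem, hP_def, Ideal.mem_comap]
    have h := hθ j hj
    rwa [MvPolynomial.aeval_X] at h
  -- the residue point lies off `V(hs)`
  have hoffb : ∃ h ∈ hs, MvPolynomial.aeval (fun i : Fin n => Ideal.Quotient.mk P (MvPolynomial.X i)) h ≠ 0 := by
    obtain ⟨h, hh, hhQ'⟩ := hhQ
    refine ⟨h, hh, fun h0 => hhQ' ?_⟩
    rw [haev, Ideal.Quotient.eq_zero_iff_mem, hP_def, Ideal.mem_comap] at h0
    exact h0
  have hfed' := hfed (MvPolynomial (Fin n) k ⧸ P) (fun i : Fin n => Ideal.Quotient.mk P (MvPolynomial.X i)) hgb hθb hoffb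
  have hfrobP := FrobeniusPowerOfFedderAt.frobeniusPower_of_fedderAt p k n (gs 0) P hfed'
  obtain ⟨m, gens, hgens⟩ := Submodule.fg_iff_exists_fin_generating_family.mp
    ((isNoetherianRing_iff_ideal_fg _).mp inferInstance P)
  have hfed'' : gs 0 ^ (p - 1) ∉ Ideal.span (Set.range fun i : Fin m => gens i ^ p) := by
    intro h
    apply hfrobP
    refine (Ideal.span_le.mpr ?_) h
    rintro _ ⟨i, rfl⟩
    exact pow_mem_frobeniusPower (by rw [← hgens]; exact Submodule.subset_span ⟨i, rfl⟩)
  -- the clause upstairs in `k[Y]_P ⧸ (g)`, then transport to `(k[Y]/(g))_(Q')`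
  have hL := (FedderAtMaximalIdeal.fedder_criterion_maximalIdeal k n m p P gens hgens.symm (gs 0) hgP hg0).mpr hfed''
  have heq : Ideal.span {algebraMap (MvPolynomial (Fin n) k) (Localization.AtPrime P) (gs 0)} =
      (Ideal.span (Set.range gs)).map (algebraMap (MvPolynomial (Fin n) k) (Localization.AtPrime P)) := by
    apply le_antisymm
    · rw [Ideal.span_le, Set.singleton_subset_iff]
      exact Ideal.mem_map_of_mem _ (Ideal.subset_span (Set.mem_range_self 0))
    · rw [Ideal.map_le_iff_le_comap, Ideal.span_le]
      rintro _ ⟨i, rfl⟩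
      obtain rfl : i = 0 := Fin.fin_one_eq_zero i
      rw [SetLike.mem_coe, Ideal.mem_comap]
      exact Ideal.mem_span_singleton_self _
  obtain ⟨e₂⟩ := CIFedderAtMaximalIdeal.nonempty_quotLocalizationEquiv (MvPolynomial (Fin n) k)
    (Ideal.span (Set.range gs)) Q'
  have e : (Localization.AtPrime P ⧸
      Ideal.span {algebraMap (MvPolynomial (Fin n) k) (Localization.AtPrime P) (gs 0)}) ≃+*
        Localization.AtPrime Q' :=
    (Ideal.quotEquivOfEq heq).trans e₂
  exact DegreeZeroDescent.inlineClause_of_ringEquiv p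
    (L := Localization.AtPrime P ⧸
      Ideal.span {algebraMap (MvPolynomial (Fin n) k) (Localization.AtPrime P) (gs 0)})
    (L' := Localization.AtPrime Q') e hL

/-- **(N5c, glued, `Set.range` form) the chart clause at the maximal ideals over the centre that avoid `V(hs)`** — plug as the
off-`V(P_c)` `hon` of a level-1 toric chart with `gs = ![g_c]`. [folklore; cite: Fedder1983, Prop. 1.7 and Thm. 1.12] -/
theorem honQuot_of_kLocCells_off_range (J : Finset (Fin n)) (V : Matrix (Fin n) (Fin n) ℕ) (gs : Fin 1 → MvPolynomial (Fin n) k)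
    (hg0 : gs 0 ≠ 0) (hX : ∀ i : Fin n, ¬ (MvPolynomial.X i ∣ gs 0))
    (SS SSoff : List (Finset (Fin n))) (hs : List (MvPolynomial (Fin n) k))
    (hcov : ∀ T : Finset (Fin n), (∀ j ∈ J, ∃ i ∈ T, 0 < V i j) → (∃ S ∈ SS, S ⊆ T) ∨ (∃ S ∈ SSoff, S ⊆ T))
    (hcells : ∀ S ∈ SS, ∃ (L : List ((Fin n →₀ ℕ) × MvPolynomial (Fin n) k)) (rr : List (MvPolynomial (Fin n) k))
        (t : Fin n → MvPolynomial (Fin n) k) (t₀ : MvPolynomial (Fin n) k),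
        (L.map Prod.fst).Nodup ∧ (∀ e ∈ L, ∀ i : Fin n, e.1 i < p) ∧
        gs 0 ^ (p - 1) = (L.map fun e => MvPolynomial.monomial e.1 (1 : k) * MvPolynomial.expand p e.2).sum ∧
        (1 : MvPolynomial (Fin n) k) = (List.zipWith (fun r e => r * MvPolynomial.expand p e.2) rr L).sum +
          ∑ i ∈ S, t i * MvPolynomial.X i + t₀ * gs 0)
    (hcellsOff : ∀ S ∈ SSoff, ∀ h ∈ hs, ∃ (L : List ((Fin n →₀ ℕ) × MvPolynomial (Fin n) k)) (rr : List (MvPolynomial (Fin n) k))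
        (t : Fin n → MvPolynomial (Fin n) k) (t₀ : MvPolynomial (Fin n) k) (m : ℕ),
        (L.map Prod.fst).Nodup ∧ (∀ e ∈ L, ∀ i : Fin n, e.1 i < p) ∧
        gs 0 ^ (p - 1) = (L.map fun e => MvPolynomial.monomial e.1 (1 : k) * MvPolynomial.expand p e.2).sum ∧
        h ^ m = (List.zipWith (fun r e => r * MvPolynomial.expand p e.2) rr L).sum +
          ∑ i ∈ S, t i * MvPolynomial.X i + t₀ * gs 0) :
    ∀ (Q' : Ideal (MvPolynomial (Fin n) k ⧸ Ideal.span (Set.range gs))) [Q'.IsMaximal],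
      (∀ j ∈ J, Ideal.Quotient.mk (Ideal.span (Set.range gs))
        (aeval (fun j : Fin n => ∏ i : Fin n, (X i : MvPolynomial (Fin n) k) ^ V i j) (X j : MvPolynomial (Fin n) k)) ∈ Q') →
      (∃ h ∈ hs, Ideal.Quotient.mk (Ideal.span (Set.range gs)) h ∉ Q') →
        (∀ i : Fin n, (X i : MvPolynomial (Fin n) k) ∈ Q'.comap (Ideal.Quotient.mk (Ideal.span (Set.range gs))) →
          IsSMulRegular (Localization.AtPrime (Q'.comap (Ideal.Quotient.mk (Ideal.span (Set.range gs)))) ⧸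
              (Ideal.span (Set.range gs)).map (algebraMap (MvPolynomial (Fin n) k)
                (Localization.AtPrime (Q'.comap (Ideal.Quotient.mk (Ideal.span (Set.range gs)))))))
            (algebraMap (MvPolynomial (Fin n) k)
              (Localization.AtPrime (Q'.comap (Ideal.Quotient.mk (Ideal.span (Set.range gs))))) (X i))) ∧
        ∀ dd : ℕ, ringKrullDim (Localization.AtPrime Q') = dd → ∀ s : Fin dd → Localization.AtPrime Q',
          (Ideal.span (Set.range s)).radical.IsMaximal →
            RingTheory.Sequence.IsWeaklyRegular (Localization.AtPrime Q') (List.ofFn s) ∧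
            ∀ y : Localization.AtPrime Q', (∃ e : ℕ, y ^ p ^ e ∈ Ideal.span
              ((fun z : Localization.AtPrime Q' => z ^ p ^ e) ''
                (Ideal.span (Set.range s) : Set (Localization.AtPrime Q')))) → y ∈ Ideal.span (Set.range s) :=
  quotientChartClause_of_pointFedder_off_range p k n J V gs hg0 hX hs fun K _ _ b hgb hθ hoff =>
    pointFedder_of_kLocCells_off p k n J V (gs 0) SS SSoff hs hcov hcells hcellsOff K b hgb hθ hoff

/-- **(N5c, glued, `Set.range` form, `¬ P ≤ Q'` currency)**: the clause at every maximal `Q'` over the centre with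
`¬ (span hs)·(k[Y]/(gs)) ≤ Q'` (N5d's `hchart` shape on a toric chart). [folklore; cite: Fedder1983, Prop. 1.7 and Thm. 1.12] -/
theorem honQuot_of_kLocCells_off_range' (J : Finset (Fin n)) (V : Matrix (Fin n) (Fin n) ℕ) (gs : Fin 1 → MvPolynomial (Fin n) k)
    (hg0 : gs 0 ≠ 0) (hX : ∀ i : Fin n, ¬ (MvPolynomial.X i ∣ gs 0))
    (SS SSoff : List (Finset (Fin n))) (hs : List (MvPolynomial (Fin n) k))
    (hcov : ∀ T : Finset (Fin n), (∀ j ∈ J, ∃ i ∈ T, 0 < V i j) → (∃ S ∈ SS, S ⊆ T) ∨ (∃ S ∈ SSoff, S ⊆ T))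
    (hcells : ∀ S ∈ SS, ∃ (L : List ((Fin n →₀ ℕ) × MvPolynomial (Fin n) k)) (rr : List (MvPolynomial (Fin n) k))
        (t : Fin n → MvPolynomial (Fin n) k) (t₀ : MvPolynomial (Fin n) k),
        (L.map Prod.fst).Nodup ∧ (∀ e ∈ L, ∀ i : Fin n, e.1 i < p) ∧
        gs 0 ^ (p - 1) = (L.map fun e => MvPolynomial.monomial e.1 (1 : k) * MvPolynomial.expand p e.2).sum ∧
        (1 : MvPolynomial (Fin n) k) = (List.zipWith (fun r e => r * MvPolynomial.expand p e.2) rr L).sum +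
          ∑ i ∈ S, t i * MvPolynomial.X i + t₀ * gs 0)
    (hcellsOff : ∀ S ∈ SSoff, ∀ h ∈ hs, ∃ (L : List ((Fin n →₀ ℕ) × MvPolynomial (Fin n) k)) (rr : List (MvPolynomial (Fin n) k))
        (t : Fin n → MvPolynomial (Fin n) k) (t₀ : MvPolynomial (Fin n) k) (m : ℕ),
        (L.map Prod.fst).Nodup ∧ (∀ e ∈ L, ∀ i : Fin n, e.1 i < p) ∧
        gs 0 ^ (p - 1) = (L.map fun e => MvPolynomial.monomial e.1 (1 : k) * MvPolynomial.expand p e.2).sum ∧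
        h ^ m = (List.zipWith (fun r e => r * MvPolynomial.expand p e.2) rr L).sum +
          ∑ i ∈ S, t i * MvPolynomial.X i + t₀ * gs 0) :
    ∀ (Q' : Ideal (MvPolynomial (Fin n) k ⧸ Ideal.span (Set.range gs))) [Q'.IsMaximal],
      (∀ j ∈ J, Ideal.Quotient.mk (Ideal.span (Set.range gs))
        (aeval (fun j : Fin n => ∏ i : Fin n, (X i : MvPolynomial (Fin n) k) ^ V i j) (X j : MvPolynomial (Fin n) k)) ∈ Q') →
      ¬ (Ideal.span {x | x ∈ hs}).map (Ideal.Quotient.mk (Ideal.span (Set.range gs))) ≤ Q' →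
        ∀ dd : ℕ, ringKrullDim (Localization.AtPrime Q') = dd → ∀ s : Fin dd → Localization.AtPrime Q',
          (Ideal.span (Set.range s)).radical.IsMaximal →
            RingTheory.Sequence.IsWeaklyRegular (Localization.AtPrime Q') (List.ofFn s) ∧
            ∀ y : Localization.AtPrime Q', (∃ e : ℕ, y ^ p ^ e ∈ Ideal.span
              ((fun z : Localization.AtPrime Q' => z ^ p ^ e) ''
                (Ideal.span (Set.range s) : Set (Localization.AtPrime Q')))) → y ∈ Ideal.span (Set.range s) :=
  fun Q' _ hθ hQ => (honQuot_of_kLocCells_off_range p k n J V gs hg0 hX SS SSoff hs hcov hcells hcellsOff Q' hθ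
    (exists_mk_not_mem_of_not_map_span_le _ hs Q' hQ)).2

end ChartRange

end Summit.ResolutionOfSingularities.ResolutionOfSingularities.Theorems.FInjectiveMacaulayfication.KLocCellOff

end
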